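import Mathlib
import HarnessLib
import Literature.Probability.Percolation.MinOpenCut
import Literature.Probability.Percolation.Crossings
import Summits.CriticalPhenomena.PercolationContinuityZ3.Theses.PercBudgetLadder
import Summits.CriticalPhenomena.PercolationContinuityZ3.Theses.PercNonProliferation

/-!
# Strategist census, crux `BudgetTightness` (stmt-CriticalPhenomena-5248): the typed split in ANNULUS
# coordinates — `NonProliferation (stmt-4444) → ClusterThroughputTight → BudgetTightness`

Planner-cstrat seat `planner-cstrat-stmt-CriticalPhenomena-5248-s1-0`, 2026-08-17. CENSUS EVIDENCE
(`STRATEGY-CENSUS.md`, heading `## Decomposition`, item D2), not a registered line and not a filed route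
split. The COUNT half of the split is VERBATIM the existing crux `PercNonProliferation.NonProliferation`
(stmt-CriticalPhenomena-4444; necessary for the crux by the landed `nonProliferation_of_budgetTightness_two`),
the THROUGHPUT half `ClusterThroughputTight` is new: uniformly in `n`, with high probability no open cluster
of `B(2n)` carries more than `K` edge-disjoint crossings of the annulus `B(n) → ∂ⁱⁿB(2n)`.

* `minCut_le_of_reps_of_throughput` (pointwise, sorry-free): if `B(n)` contains no `M+1` pairwise-unjoined
  crossing representatives and every cluster throughput is `≤ K`, then `MinCut(n,2n) ≤ M·K` — a maximal
  pairwise-unjoined family of crossing representatives has `≤ M` members and meets the cluster of every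
  crossing vertex; the union of the representatives' `≤ K`-cutsets destroys every crossing because
  `{a ↔ b in S}` is increasing in the configuration.
* `budgetTightness_of_nonProliferation_of_throughputTight` (sorry-free): `Sub₁ → Sub₂ → BudgetTightness`
  with `k = M·K`, `l = 2`, constant `c/2` (`frequently ∧ eventually`, union bound).

Why recorded and NOT filed (`route edit --split`): see the census — Sub₁ is itself lead-saturated (7 leads,
3 dead lines on stmt-4444) and Sub₂ has no engine (single-cluster throughput = red-bond / level-set cutset
statement; flat cuts meet `≍ h^{D_b-1}` backbone edges). Ready to file verbatim if either input appears.
-/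

noncomputable section

namespace Summit.CriticalPhenomena.PercolationContinuityZ3.Cruxes.BudgetTightness.StrategistCensus

open MeasureTheory Filter Topology
open Literature.Probability.Percolation Literature.Probability.LatticeModels
open Summit.CriticalPhenomena.PercolationContinuityZ3.Theses.PercBudgetLadder (BudgetTightness)
open Summit.CriticalPhenomena.PercolationContinuityZ3.Theses.PercNonProliferation (NonProliferation)

/-- The region `B(2n)`, as a set. -/
abbrev Reg (n : ℕ) : Set (Site 3) := ↑(box 3 (2 * n))

/-- The target `∂ⁱⁿB(2n)`, as a set. -/
abbrev Tgt (n : ℕ) : Set (Site 3) := ↑(innerBoundary (zdGraph 3) (box 3 (2 * n)))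

/-- **Throughput of the cluster of `x`** across the annulus `B(n) → ∂ⁱⁿB(2n)`: the min-cut (= max number of
edge-disjoint open crossings, by the tree's Menger theorem) from the part of `x`'s open cluster inside `B(n)`
to `∂ⁱⁿB(2n)`, inside `B(2n)`. It is `0` when the cluster of `x` does not cross. -/
def throughput (n : ℕ) (x : Site 3) (ω : BondConfig (Site 3)) : ℕ∞ :=
  minOpenCutIn (Reg n) {a | a ∈ box 3 n ∧ ω ∈ openConnIn (Reg n) x a} (Tgt n) ω

/-- **Sub₂ — uniform tightness of the maximal per-cluster throughput at `p_c(ℤ³)`.** For every `ε > 0`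
there is `K` such that for all large `n`, with probability `≥ 1 - ε` no open cluster of `B(2n)` carries more
than `K` edge-disjoint open crossings of `B(n) → ∂ⁱⁿB(2n)`. (Its i.o. weakening is necessary for the crux by
`budgetTightness_iff_tight_two`; FALSE for `p > p_c`, where the giant carries `≍ n²` crossings.) -/
def ClusterThroughputTight : Prop :=
  ∀ ε : ℝ, 0 < ε → ∃ K : ℕ, ∀ᶠ n : ℕ in atTop,
    (bondPercolation (zdGraph 3) (criticalProbI 3)).real
      {ω | ∃ x ∈ box 3 n, (K : ℕ∞) < throughput n x ω} ≤ ε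

/-- `{x ↔ y in S}` is symmetric (local copy, by definition). -/
theorem openConnIn_symm_mem {S : Set (Site 3)} {x y : Site 3} {ω : BondConfig (Site 3)}
    (h : ω ∈ openConnIn S x y) : ω ∈ openConnIn S y x := by
  obtain ⟨hx, hy, hr⟩ := h
  exact ⟨hy, hx, hr.symm⟩

/-- `{x ↔ x in S}` holds for `x ∈ S` (local copy, by definition). -/
theorem openConnIn_refl_mem {S : Set (Site 3)} {x : Site 3} {ω : BondConfig (Site 3)} (hx : x ∈ S) :
    ω ∈ openConnIn S x x :=
  ⟨hx, hx, SimpleGraph.Reachable.refl _⟩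

/-- `a` is a crossing vertex: joined inside `B(2n)` to `∂ⁱⁿB(2n)`. -/
def Cross (n : ℕ) (ω : BondConfig (Site 3)) (a : Site 3) : Prop :=
  ∃ y ∈ Tgt n, ω ∈ openConnIn (Reg n) a y

/-- A finite family of vertices is pairwise unjoined inside `B(2n)`. -/
def Indep (n : ℕ) (ω : BondConfig (Site 3)) (I : Finset (Site 3)) : Prop :=
  ∀ a ∈ I, ∀ b ∈ I, a ≠ b → ω ∉ openConnIn (Reg n) a b

/-- **Pointwise: `MinCut ≤ (#crossing clusters) · (max throughput)`.** If `B(n)` contains no `M+1`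
pairwise-unjoined crossing representatives (the complement of stmt-4444's `repEvent`) and every cluster
throughput is at most `K`, then at most `M·K` edges destroy every open crossing of `B(n) → ∂ⁱⁿB(2n)` inside
`B(2n)`. -/
theorem minCut_le_of_reps_of_throughput {M K n : ℕ} {ω : BondConfig (Site 3)}
    (hM : ¬ ∃ x : Fin (M + 1) → Site 3, (∀ i, x i ∈ box 3 n) ∧
      (∀ i, ∃ y ∈ innerBoundary (zdGraph 3) (box 3 (2 * n)), ω ∈ openConnIn (Reg n) (x i) y) ∧
      ∀ i j, i ≠ j → ω ∉ openConnIn (Reg n) (x i) (x j))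
    (hK : ∀ x ∈ box 3 n, throughput n x ω ≤ K) :
    minOpenCutIn (Reg n) (↑(box 3 n) : Set (Site 3)) (Tgt n) ω ≤ ((M * K : ℕ) : ℕ∞) := by
  classical
  -- a pairwise-unjoined family of crossing vertices of `B(n)` of maximal cardinality
  obtain ⟨I, hIfam, hmax⟩ := Finset.exists_max_image
    (((box 3 n).filter (Cross n ω)).powerset.filter (Indep n ω))
    Finset.card ⟨∅, Finset.mem_filter.2 ⟨Finset.mem_powerset.2 (Finset.empty_subset _),
      fun a ha => absurd ha (Finset.notMem_empty a)⟩⟩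
  obtain ⟨hIpow, hIind⟩ := Finset.mem_filter.1 hIfam
  simp only [Indep] at hIind
  have hIsub := Finset.mem_powerset.1 hIpow
  have hIbox : ∀ a ∈ I, a ∈ box 3 n := fun a ha => (Finset.mem_filter.1 (hIsub ha)).1
  have hIcross : ∀ a ∈ I, ∃ y ∈ Tgt n, ω ∈ openConnIn (Reg n) a y :=
    fun a ha => (Finset.mem_filter.1 (hIsub ha)).2
  -- (1) at most `M` members, else `M+1` of them witness `repEvent`
  have hcard : I.card ≤ M := by
    by_contra hlt
    push Not at hlt
    obtain ⟨J, hJI, hJ⟩ := Finset.exists_subset_card_eq (Nat.succ_le_of_lt hlt)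
    have hJcard : Fintype.card {a // a ∈ J} = M + 1 := by rw [Fintype.card_coe]; exact hJ
    let e : Fin (M + 1) ≃ {a // a ∈ J} := (Fintype.equivFinOfCardEq hJcard).symm
    apply hM
    refine ⟨fun i => ((e i : {a // a ∈ J}) : Site 3), fun i => hIbox _ (hJI (e i).2),
      fun i => ?_, fun i j hij => hIind _ (hJI (e i).2) _ (hJI (e j).2) ?_⟩
    · obtain ⟨y, hy, h⟩ := hIcross _ (hJI (e i).2)
      exact ⟨y, hy, h⟩
    · intro heq
      exact hij (e.injective (Subtype.ext heq))
  -- (2) every crossing vertex of `B(n)` is joined to a member of the family (maximality)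
  have hcover : ∀ a ∈ box 3 n, (∃ y ∈ Tgt n, ω ∈ openConnIn (Reg n) a y) →
      ∃ x ∈ I, ω ∈ openConnIn (Reg n) x a := by
    intro a ha hca
    by_contra hno
    push Not at hno
    have haS : a ∈ Reg n := by
      have : box 3 n ⊆ box 3 (2 * n) := box_mono 3 (by omega)
      exact Finset.mem_coe.2 (this ha)
    have haI : a ∉ I := fun h => hno a h (openConnIn_refl_mem haS)
    have hins : insert a I ∈ (((box 3 n).filter (Cross n ω)).powerset.filter (Indep n ω)) := by
      refine Finset.mem_filter.2 ⟨Finset.mem_powerset.2 ?_, ?_⟩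
      · intro b hb
        rcases Finset.mem_insert.1 hb with rfl | hbI
        · exact Finset.mem_filter.2 ⟨ha, hca⟩
        · exact hIsub hbI
      · intro b hb b' hb' hne
        rcases Finset.mem_insert.1 hb with rfl | hbI
        · rcases Finset.mem_insert.1 hb' with rfl | hb'I
          · exact absurd rfl hne
          · exact fun h => hno b' hb'I (openConnIn_symm_mem h)
        · rcases Finset.mem_insert.1 hb' with rfl | hb'I
          · exact hno b hbI
          · exact hIind b hbI b' hb'I hne
    have := hmax _ hins
    rw [Finset.card_insert_of_notMem haI] at this
    omega
  -- (3) glue the representatives' cutsets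
  have hT : ∀ x ∈ I, ∃ T : Finset (Sym2 (Site 3)), T.card ≤ K ∧
      ¬ ∃ a ∈ {a | a ∈ box 3 n ∧ ω ∈ openConnIn (Reg n) x a}, ∃ b ∈ Tgt n,
        (ω \ ↑T) ∈ openConnIn (Reg n) a b :=
    fun x hx => minOpenCutIn_le_iff.1 (hK x (hIbox x hx))
  choose! T hTcard hTcut using hT
  have hcut : ¬ ∃ a ∈ (↑(box 3 n) : Set (Site 3)), ∃ b ∈ Tgt n,
      (ω \ ↑(I.biUnion T)) ∈ openConnIn (Reg n) a b := by
    rintro ⟨a, ha, b, hb, hab⟩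
    have ha' : a ∈ box 3 n := Finset.mem_coe.1 ha
    have habω : ω ∈ openConnIn (Reg n) a b := isUpperSet_openConnIn (Reg n) a b Set.diff_subset hab
    obtain ⟨x, hxI, hxa⟩ := hcover a ha' ⟨b, hb, habω⟩
    refine hTcut x hxI ⟨a, ⟨ha', hxa⟩, b, hb, ?_⟩
    refine isUpperSet_openConnIn (Reg n) a b ?_ hab
    exact Set.diff_subset_diff_right (Finset.coe_subset.2 (Finset.subset_biUnion_of_mem T hxI))
  calc minOpenCutIn (Reg n) (↑(box 3 n) : Set (Site 3)) (Tgt n) ω ≤ ((I.biUnion T).card : ℕ∞) :=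
        minOpenCutIn_le_iff.2 ⟨I.biUnion T, le_rfl, hcut⟩
    _ ≤ ((M * K : ℕ) : ℕ∞) := by
        have h1 : (I.biUnion T).card ≤ ∑ x ∈ I, (T x).card := Finset.card_biUnion_le
        have h2 : ∑ x ∈ I, (T x).card ≤ ∑ x ∈ I, K := Finset.sum_le_sum fun x hx => hTcard x hx
        have h3 : ∑ x ∈ I, K = I.card * K := by simp [Finset.sum_const, smul_eq_mul]
        have h4 : I.card * K ≤ M * K := Nat.mul_le_mul_right K hcard
        exact_mod_cast h1.trans (h2.trans (h3.le.trans h4))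

/-- **GLUE (sorry-free): `NonProliferation → ClusterThroughputTight → BudgetTightness`** with `k = M·K`,
`l = 2` and constant `c/2`: along stmt-4444's subsequence the event "at most `M` crossing clusters" has
probability `≥ c`; eventually the bad-throughput event has probability `≤ c/2`; on the difference the
pointwise lemma gives `MinCut(n,2n) ≤ M·K`. -/
theorem budgetTightness_of_nonProliferation_of_throughputTight
    (hNP : NonProliferation) (hCT : ClusterThroughputTight) : BudgetTightness := by
  obtain ⟨M, c, hc, hfreq⟩ := hNP
  obtain ⟨K, hK⟩ := hCT (c / 2) (by positivity)
  refine ⟨M * K, 2, c / 2, le_rfl, by positivity, fun N => ?_⟩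
  obtain ⟨n, hcn, hNn, hbad⟩ := (hfreq.and_eventually ((eventually_ge_atTop N).and hK)).exists
  refine ⟨n, hNn, ?_⟩
  have hsub :
      {ω : BondConfig (Site 3) | ¬ ∃ x : Fin (M + 1) → Site 3, (∀ i, x i ∈ box 3 n) ∧
        (∀ i, ∃ y ∈ innerBoundary (zdGraph 3) (box 3 (2 * n)),
          ω ∈ openConnIn (↑(box 3 (2 * n)) : Set (Site 3)) (x i) y) ∧
        ∀ i j, i ≠ j → ω ∉ openConnIn (↑(box 3 (2 * n)) : Set (Site 3)) (x i) (x j)} ⊆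
      {ω | ∃ S : Finset (Sym2 (Site 3)), S.card ≤ M * K ∧
        ¬ ∃ x ∈ box 3 n, ∃ y ∈ innerBoundary (zdGraph 3) (box 3 (2 * n)),
          (ω \ ↑S) ∈ openConnIn (↑(box 3 (2 * n)) : Set (Site 3)) x y} ∪
      {ω | ∃ x ∈ box 3 n, (K : ℕ∞) < throughput n x ω} := by
    intro ω hω
    by_cases hb : ω ∈ {ω : BondConfig (Site 3) | ∃ x ∈ box 3 n, (K : ℕ∞) < throughput n x ω}
    · exact Or.inr hb
    · left
      have hK' : ∀ x ∈ box 3 n, throughput n x ω ≤ K :=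
        fun x hx => not_lt.1 fun h => hb ⟨x, hx, h⟩
      obtain ⟨T, hTcard, hTcut⟩ := minOpenCutIn_le_iff.1 (minCut_le_of_reps_of_throughput hω hK')
      refine ⟨T, hTcard, ?_⟩
      rintro ⟨x, hx, y, hy, hxy⟩
      exact hTcut ⟨x, Finset.mem_coe.2 hx, y, Finset.mem_coe.2 hy, hxy⟩
  have h1 := (measureReal_mono hsub
    (measure_ne_top (bondPercolation (zdGraph 3) (criticalProbI 3)) _)).trans
    (measureReal_union_le _ _)
  linarith

end Summit.CriticalPhenomena.PercolationContinuityZ3.Cruxes.BudgetTightness.StrategistCensus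

end
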